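import Summits.BirchSwinnertonDyer.Rank1Residual.X12.CMRamifiedRecordSchemaIMeaningLocal
import Summits.BirchSwinnertonDyer.Rank1Residual.X12.CMRamifiedRecordSchemaIMeaningPlaces
import Summits.BirchSwinnertonDyer.Rank1Residual.X12.O11.RamifiedEllipticUnitMechanismZpThreeGr
import Summits.BirchSwinnertonDyer.Rank1Residual.AdditivePotMult.QuadraticBaseChangeNormValuation
import Literature.NumberTheory.EllipticCurves.TamagawaFiniteIndexProofs
import HarnessLib

/-!
# PART I MEANING — `ord₃ (inertTamagawaProductThree W K) = tcsClosedForm k`: the displayed inert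
# `3`-Tamagawa exponent `t_cs` of the carriers (IMC)₃♮ / (PR|IMC)₃♮, BY NAME, for every Mordell curve
# (cell `bsd-print-cfram`, typer seat `ty3`; consumes `X12/CMRamifiedRecordSchemaI{,MeaningLocal,MeaningPlaces}.lean`)

HONEST FRAMING (cell `bsd-print-cfram`, run/shared/lean/pub/bsd-print-cfram/, verbatim in every file
of the cell): PARTITION currency only — the leaf counts when its class theorem is in the kernel BY
NAME, flag-free; Literature named facts are statement-only with cite tags, never sorried theorems;
every imported theorem carries its printed hypotheses verbatim; numbers, not adjectives. THIS FILE: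
THEOREMS ONLY (no definition, no named fact, no `sorry`); nothing about BSD is asserted or booked; the
carriers (IMC)₃♮ / (PR|IMC)₃♮ (`X12/O11/RamifiedEllipticUnitMechanismZpThreeGr.lean`) stay
`@[conjecture]`; regime children N / T / V of crux C1 stay OPEN; no mark moves.

## What is here

* `padicValNat_inertTamagawaProductThree_eq_tcsClosedForm` — for `K` a number field with `[K : ℚ] = 2`
  and `d_K = −3`, and `W/ℚ` elliptic with a model `C • W = (y² = x³ + k)`, `k ≠ 0`, `64 ∤ k`:
  `padicValNat 3 (X12.O11.inertTamagawaProductThree W K) = tcsClosedForm k`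
  `= [v₂(k) ∈ {0,2} ∧ k/2^{v₂ k} ≡ 1 (4)] + #{ℓ ≥ 5 prime : ℓ ≡ 2 (3), v_ℓ(k) mod 6 ∈ {2,4}}`.
  Proof: the `finprod` over the places of `K` is a finite product (tree
  `mulSupport_localTamagawaNumber_finite_holds`), `ord₃` of it is the sum of the `ord₃ c_w(W_K)` over
  the places `w ∤ 3` of inertia degree `2` (`padicValNat_finprod_eq_finsum`); each such `w` is alone
  above its prime `ℓ ∈ {2} ∪ {ℓ ≡ 2 (3)}`, `e = 1` (MeaningPlaces), so `ord₃ c_w(W_K)` is the local bit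
  of MeaningLocal §4; and `w ↦ ℓ` is a bijection onto the primes counted by `tcsClosedForm k`
  (`exists_inertiaDeg_eq_two_of_prime` for surjectivity).
* `padicValNat_inertTamagawaProductThree_eq_of_isFrameThree` — the same at a `3`-frame of the cell
  (`X12.O11.IsFrameThree W K 𝔭 W' C'`: `K` imaginary quadratic with `d_K = −3`).
* `TcsRow.padicValNat_inertTamagawaProductThree_eq` — **a consistent `TcsRow` (the 919 rows of
  `X12/CMRamifiedTcsThree{A..F}.lean`) displays `t_cs` BY NAME**: for every `W` with
  `C • W = (y² = x³ + r.k)`, `padicValNat 3 (inertTamagawaProductThree W K) = r.tcs`.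

So the term `t_cs` of (IMC)₃♮ / (PR|IMC)₃♮ is, class by class, the kernel-checked number in the PART I
displays (N 219/425, T_cube 133/178, T_split 116/296, V 0/20 classes with `t_cs ≥ 1`).

References: [PollackWeston2011] Def. 3.3, Lemma 3.4, Prop. 3.7 (arXiv:math/0610694 pp. 7–8: the
Tamagawa exponents at inert primes); [SilvermanATAEC1994] IV.9.4 and Table 4.1; [NeukirchANT1999]
Ch. I (8.5); HOME/ty3/CERT-TABLE-K12r.md §PART I; REFEREE.md R0.28.
-/

noncomputable section

open scoped Classical NumberField
open WeierstrassCurve NumberField IsDedekindDomain IsDedekindDomain.HeightOneSpectrum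
  Rat.HeightOneSpectrum Literature.NumberTheory.EllipticCurves
  Literature.NumberTheory.GaloisRepresentations

namespace Summit.BirchSwinnertonDyer.Rank1Residual.X12.CMRamifiedRecords

section Assembly

variable (K : Type) [Field K] [NumberField K] (W : WeierstrassCurve ℚ) [W.IsElliptic]
  {C : VariableChange ℚ} {k : ℤ}

/-- `tcsClosedForm k` as the cardinality of ONE `Finset` of primes: `{2 ∣ bit} ∪ {ℓ ≥ 5 ∣ …}`.
[folklore] -/
theorem tcsClosedForm_eq_card (k : ℤ) :
    tcsClosedForm k =
      ((if twoAdicIVBit k (k.natAbs.factorization 2) = 1 then {2} else ∅) ∪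
        (k.natAbs.primeFactors.filter fun ℓ =>
          5 ≤ ℓ ∧ ℓ % 3 = 2 ∧ (k.natAbs.factorization ℓ % 6 = 2 ∨ k.natAbs.factorization ℓ % 6 = 4))).card := by
  rw [Finset.card_union_of_disjoint, tcsClosedForm]
  · congr 1
    rcases twoAdicIVBit_eq_zero_or_one k (k.natAbs.factorization 2) with h | h <;> simp [h]
  · rw [Finset.disjoint_left]
    intro ℓ hℓ hℓ'
    split_ifs at hℓ with hb
    · rw [Finset.mem_singleton] at hℓ
      rw [Finset.mem_filter] at hℓ'
      omega
    · simp at hℓ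

/-- **`ord₃ (inertTamagawaProductThree W K) = tcsClosedForm k`** for `[K : ℚ] = 2`, `d_K = −3` and
`W ≅ (y² = x³ + k)`, `k ≠ 0`, `64 ∤ k` (module docstring). The inert `3`-Tamagawa exponent `t_cs` of
Pollack–Weston's minimal/Greenberg dichotomy, displayed by the carriers (IMC)₃♮ / (PR|IMC)₃♮, is the
closed form of `X12/CMRamifiedRecordSchemaI.lean`.
[cite: PollackWeston2011, Def. 3.3, Lemma 3.4 and Prop. 3.7 (arXiv:math/0610694 pp. 7–8)]
[cite: SilvermanATAEC1994, IV.9.4 and Table 4.1] -/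
theorem padicValNat_inertTamagawaProductThree_eq_tcsClosedForm (h2 : Module.finrank ℚ K = 2)
    (hd : NumberField.discr K = -3) (hM : C • W = ⟨0, 0, 0, 0, (k : ℚ)⟩) (hk : k ≠ 0)
    (h64 : ¬ (64 : ℤ) ∣ k) :
    padicValNat 3 (X12.O11.inertTamagawaProductThree W K) = tcsClosedForm k := by
  classical
  haveI : (W.baseChange K).IsElliptic := by rw [baseChange]; infer_instance
  haveI : Fact (Nat.Prime 3) := ⟨Nat.prime_three⟩
  -- the local Tamagawa function, the filtered factor, the local bit
  set c : HeightOneSpectrum (𝓞 K) → ℕ := fun w =>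
    ((W.baseChange K).baseChange (w.adicCompletion K)).localTamagawaNumber
      (w.adicCompletionIntegers K) with hc
  set g : HeightOneSpectrum (𝓞 K) → ℕ := fun w =>
    if ((3 : ℕ) : 𝓞 K) ∉ w.asIdeal ∧ w.asIdeal.inertiaDeg (𝓞 ℚ) = 2 then c w else 1 with hg
  have hdef : X12.O11.inertTamagawaProductThree W K = ∏ᶠ w, g w := rfl
  set bit : ℕ → ℕ := fun ℓ => if ℓ = 2 then twoAdicIVBit k (k.natAbs.factorization 2)
      else if k.natAbs.factorization ℓ % 6 = 2 ∨ k.natAbs.factorization ℓ % 6 = 4 then 1 else 0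
    with hbit
  have hbit01 : ∀ ℓ, bit ℓ = 0 ∨ bit ℓ = 1 := by
    intro ℓ
    simp only [hbit]
    split_ifs
    · exact twoAdicIVBit_eq_zero_or_one _ _
    · exact Or.inr rfl
    · exact Or.inl rfl
  -- the contributing places
  set P : HeightOneSpectrum (𝓞 K) → Prop := fun w =>
    (((3 : ℕ) : 𝓞 K) ∉ w.asIdeal ∧ w.asIdeal.inertiaDeg (𝓞 ℚ) = 2) ∧
      bit (natGenerator (w.under (𝓞 ℚ))) = 1 with hP
  -- `ord₃ g(w) = [P w]`
  have hval : ∀ w, padicValNat 3 (g w) = if P w then 1 else 0 := by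
    intro w
    by_cases hQ : ((3 : ℕ) : 𝓞 K) ∉ w.asIdeal ∧ w.asIdeal.inertiaDeg (𝓞 ℚ) = 2
    · have hgw : g w = c w := by simp only [hg, if_pos hQ]
      obtain ⟨-, he⟩ := fibre_eq_singleton_of_inertiaDeg_eq_two h2 w hQ.2
      have hℓ3 : natGenerator (w.under (𝓞 ℚ)) ≠ 3 := fun h => hQ.1 ((three_mem_asIdeal_iff w).2 h)
      have hloc := padicValNat_localTamagawaNumber_baseChange_of_mordell (K := K) W (w.under (𝓞 ℚ))
        hM hk h64 rfl he hQ.2 hℓ3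
      have hloc' : padicValNat 3 (c w) = bit (natGenerator (w.under (𝓞 ℚ))) := by
        rw [hc]; exact hloc
      rw [hgw, hloc']
      by_cases hb : bit (natGenerator (w.under (𝓞 ℚ))) = 1
      · rw [if_pos (show P w from ⟨hQ, hb⟩)]; exact hb
      · rw [if_neg (show ¬ P w from fun h => hb h.2)]
        rcases hbit01 (natGenerator (w.under (𝓞 ℚ))) with h0 | h1
        · exact h0
        · exact absurd h1 hb
    · have hgw : g w = 1 := by simp only [hg, if_neg hQ]
      rw [hgw, if_neg (show ¬ P w from fun h => hQ h.1)]
      simp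
  -- finiteness and non-vanishing
  have hfinc : (Function.mulSupport c).Finite := (W.baseChange K).mulSupport_localTamagawaNumber_finite_holds
  have hsub : Function.mulSupport g ⊆ Function.mulSupport c := by
    intro w hw
    rw [Function.mem_mulSupport] at hw ⊢
    by_cases hQ : ((3 : ℕ) : 𝓞 K) ∉ w.asIdeal ∧ w.asIdeal.inertiaDeg (𝓞 ℚ) = 2
    · simpa only [hg, if_pos hQ] using hw
    · exact absurd (by simp only [hg, if_neg hQ]) hw
  have hfin : (Function.mulSupport g).Finite := hfinc.subset hsub
  have hg0 : ∀ w, g w ≠ 0 := by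
    intro w
    by_cases hQ : ((3 : ℕ) : 𝓞 K) ∉ w.asIdeal ∧ w.asIdeal.inertiaDeg (𝓞 ℚ) = 2
    · simp only [hg, if_pos hQ]; exact (W.baseChange K).localTamagawaNumber_baseChange_ne_zero w
    · simp only [hg, if_neg hQ]; exact one_ne_zero
  rw [hdef, AdditivePotMult.padicValNat_finprod_eq_finsum 3 hfin hg0, finsum_congr hval]
  -- the indicator sum is a finite cardinality
  set S : Finset (HeightOneSpectrum (𝓞 K)) := hfin.toFinset with hS
  have hPS : ∀ w, P w → w ∈ S := by
    intro w hw
    rw [hS, Set.Finite.mem_toFinset, Function.mem_mulSupport]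
    intro h1
    have := hval w
    rw [h1, if_pos hw] at this
    simp at this
  have hsupp : Function.support (fun w => if P w then 1 else 0) ⊆ (S : Set (HeightOneSpectrum (𝓞 K))) := by
    intro w hw
    rw [Function.mem_support] at hw
    have hPw : P w := by by_contra h; exact hw (if_neg h)
    exact hPS w hPw
  rw [finsum_eq_finsetSum_of_support_subset _ hsupp, ← Finset.card_filter, tcsClosedForm_eq_card]
  -- membership in the target `Finset`
  set T : Finset ℕ := (if twoAdicIVBit k (k.natAbs.factorization 2) = 1 then {2} else ∅) ∪
    (k.natAbs.primeFactors.filter fun ℓ =>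
      5 ≤ ℓ ∧ ℓ % 3 = 2 ∧ (k.natAbs.factorization ℓ % 6 = 2 ∨ k.natAbs.factorization ℓ % 6 = 4)) with hT
  have hkn : k.natAbs ≠ 0 := Int.natAbs_ne_zero.2 hk
  have hTmem : ∀ ℓ, ℓ ∈ T ↔ ℓ.Prime ∧ (ℓ = 2 ∨ (5 ≤ ℓ ∧ ℓ % 3 = 2)) ∧ bit ℓ = 1 := by
    intro ℓ
    rw [hT, Finset.mem_union, Finset.mem_filter, Nat.mem_primeFactors]
    constructor
    · rintro (h | ⟨⟨hp, hdvd, -⟩, h5, h3, h24⟩)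
      · split_ifs at h with hb
        · rw [Finset.mem_singleton] at h
          subst h
          exact ⟨Nat.prime_two, Or.inl rfl, by simp only [hbit, if_true]; exact hb⟩
        · simp at h
      · refine ⟨hp, Or.inr ⟨h5, h3⟩, ?_⟩
        simp only [hbit, if_neg (show ℓ ≠ 2 by omega), if_pos h24]
    · rintro ⟨hp, h2or, hb⟩
      rcases h2or with rfl | ⟨h5, h3⟩
      · left
        have hb' : twoAdicIVBit k (k.natAbs.factorization 2) = 1 := by
          simpa only [hbit, if_true] using hb
        rw [if_pos hb']
        exact Finset.mem_singleton_self 2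
      · right
        have hℓ2 : ℓ ≠ 2 := by omega
        have h24 : k.natAbs.factorization ℓ % 6 = 2 ∨ k.natAbs.factorization ℓ % 6 = 4 := by
          by_contra h
          simp only [hbit, if_neg hℓ2, if_neg h] at hb
          exact zero_ne_one hb
        have hne : k.natAbs.factorization ℓ ≠ 0 := by omega
        exact ⟨⟨hp, Nat.dvd_of_factorization_pos hne, hkn⟩, h5, h3, h24⟩
  -- the bijection `w ↦ ℓ`
  apply Finset.card_nbij (fun w => natGenerator (w.under (𝓞 ℚ)))
  · -- maps to
    intro w hw
    rw [Finset.mem_coe, Finset.mem_filter] at hw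
    obtain ⟨-, hQ, hb⟩ := hw
    obtain ⟨-, h2or⟩ := natGenerator_of_inertiaDeg_eq_two h2 hd w hQ.2
    rw [Finset.mem_coe, hTmem]
    exact ⟨prime_natGenerator _, h2or, hb⟩
  · -- injective
    intro w₁ hw₁ w₂ hw₂ heq
    rw [Finset.mem_coe, Finset.mem_filter] at hw₁ hw₂
    have hv : w₁.under (𝓞 ℚ) = w₂.under (𝓞 ℚ) := Rat.natGenerator_injective heq
    obtain ⟨hset, -⟩ := fibre_eq_singleton_of_inertiaDeg_eq_two h2 w₁ hw₁.2.1.2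
    have hmem : w₂ ∈ ({w₁} : Set (HeightOneSpectrum (𝓞 K))) := by rw [← hset]; exact hv.symm
    exact (Set.mem_singleton_iff.1 hmem).symm
  · -- surjective
    intro ℓ hℓ
    rw [Finset.mem_coe, hTmem] at hℓ
    obtain ⟨hp, h2or, hb⟩ := hℓ
    obtain ⟨w, hwℓ, -, he, hf⟩ := exists_inertiaDeg_eq_two_of_prime (K := K) h2 hd hp h2or
    have hℓ3 : ℓ ≠ 3 := by omega
    have hQ : ((3 : ℕ) : 𝓞 K) ∉ w.asIdeal ∧ w.asIdeal.inertiaDeg (𝓞 ℚ) = 2 :=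
      ⟨fun h => hℓ3 (hwℓ ▸ (three_mem_asIdeal_iff w).1 h), hf⟩
    have hPw : P w := ⟨hQ, by rw [hwℓ]; exact hb⟩
    refine ⟨w, ?_, hwℓ⟩
    rw [Finset.mem_coe, Finset.mem_filter]
    exact ⟨hPS w hPw, hPw⟩

/-- **At a `3`-frame of the cell** (`X12.O11.IsFrameThree W K 𝔭 W' C'`: `W` has CM, `3 ∣ d_K`, `K`
imaginary quadratic with `d_K = −3`): `ord₃ (inertTamagawaProductThree W K) = tcsClosedForm k` for any
Mordell model `C • W = (y² = x³ + k)`, `64 ∤ k`. [cite: PollackWeston2011, Def. 3.3 and Prop. 3.7 (arXiv:math/0610694 pp. 7–8)] -/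
theorem padicValNat_inertTamagawaProductThree_eq_of_isFrameThree [W.IsGloballyMinimal]
    {𝔭 : HeightOneSpectrum (𝓞 K)} {W' : WeierstrassCurve ℚ} {C' : VariableChange ℚ}
    (hF : X12.O11.IsFrameThree W K 𝔭 W' C') (hM : C • W = ⟨0, 0, 0, 0, (k : ℚ)⟩) (hk : k ≠ 0)
    (h64 : ¬ (64 : ℤ) ∣ k) :
    padicValNat 3 (X12.O11.inertTamagawaProductThree W K) = tcsClosedForm k :=
  padicValNat_inertTamagawaProductThree_eq_tcsClosedForm K W hF.2.2.1.1 hF.discr_eq hM hk h64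

end Assembly

/-! ### The displays read BY NAME -/

/-- **A consistent `TcsRow` displays `t_cs` by name**: for every number field `K` with `[K : ℚ] = 2`,
`d_K = −3`, and every `W/ℚ` with a model `C • W = (y² = x³ + r.k)`,
`padicValNat 3 (inertTamagawaProductThree W K) = r.tcs` (the row certifies `r.tcs = tcsClosedForm r.k`,
`r.k ≠ 0`, `64 ∤ r.k`). Applies to each of the 919 rows of `X12/CMRamifiedTcsThree{A..F}.lean` through
`TcsRow.consistent_of_tcsCheck`. [cite: PollackWeston2011, Def. 3.3 and Prop. 3.7 (arXiv:math/0610694 pp. 7–8)] -/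
theorem TcsRow.padicValNat_inertTamagawaProductThree_eq {r : TcsRow} (hr : r.consistent = true)
    (K : Type) [Field K] [NumberField K] (h2 : Module.finrank ℚ K = 2) (hd : NumberField.discr K = -3)
    (W : WeierstrassCurve ℚ) [W.IsElliptic] {C : VariableChange ℚ}
    (hM : C • W = ⟨0, 0, 0, 0, (r.k : ℚ)⟩) :
    padicValNat 3 (X12.O11.inertTamagawaProductThree W K) = r.tcs := by
  obtain ⟨-, hk, h64⟩ := TcsRow.factorsCheck_of_consistent hr
  rw [TcsRow.tcs_eq_tcsClosedForm_of_consistent hr]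
  exact padicValNat_inertTamagawaProductThree_eq_tcsClosedForm K W h2 hd hM hk h64

/-- The same at a `3`-frame of the cell. [cite: PollackWeston2011, Def. 3.3 and Prop. 3.7 (arXiv:math/0610694 pp. 7–8)] -/
theorem TcsRow.padicValNat_inertTamagawaProductThree_eq_of_isFrameThree {r : TcsRow}
    (hr : r.consistent = true) (K : Type) [Field K] [NumberField K]
    (W : WeierstrassCurve ℚ) [W.IsElliptic] [W.IsGloballyMinimal]
    {𝔭 : HeightOneSpectrum (𝓞 K)} {W' : WeierstrassCurve ℚ} {C' : VariableChange ℚ}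
    (hF : X12.O11.IsFrameThree W K 𝔭 W' C') {C : VariableChange ℚ}
    (hM : C • W = ⟨0, 0, 0, 0, (r.k : ℚ)⟩) :
    padicValNat 3 (X12.O11.inertTamagawaProductThree W K) = r.tcs :=
  TcsRow.padicValNat_inertTamagawaProductThree_eq hr K hF.2.2.1.1 hF.discr_eq W hM

end Summit.BirchSwinnertonDyer.Rank1Residual.X12.CMRamifiedRecords

end
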